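import Mathlib
import Summits.ResolutionOfSingularities.ResolutionOfSingularities.Theorems.WildQuotientsWildQuotientResolutionToricExitRootChartInvariants

/-!
# V3U chart a, C2 for an abstract action on the even subring given on generators

(crux stmt-ResolutionOfSingularities-15640 `WildQuotients.WildQuotientResolution`, line `Sketch`,
sector `|G| = p`; programme V3U «toric exit» of `L/w45c/CHAIN.md` v5, res-L1-w45c-lead-1's ASK
2026-08-27T02:36:08Z for the C0-equiv brick I-7; [OURS · L1 W4.5c] — NOT a statement of any
manuscript; replaces the role of no printed item.)

`chartA_fixedPoints_eq_of_generators`: let `τ` be ANY ring endomorphism of the even subalgebra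
`S = k[ρ², ρβ, β², x_c, passengers] = Algebra.adjoin k (chartAGens k n a b)` fixing the constants and
acting on the generators by the chart-a law of the Jordan block (`x_a = ρ² ↦ ρ²`,
`x_b = ρβ ↦ ρβ + ρ²`, `r = β² ↦ β² + 2ρβ + ρ²`, `x_c ↦ x_c + ρβ`, passengers fixed) — e.g. the
`⟨σ⟩`-action on the chart ring `k[x][(x_a, x_b²)/x_a]` transported by `ToricExit.chartA_ringEquiv_adjoin`
(stub-2, p486657). Then `{f ∈ S | τ f = f} = {f ∈ S | f ∈ k[ρ², ρN, N², c′, passengers]}`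
(`p ≥ 3`). Proof: `τ` agrees on `S` with THE root-chart automorphism `σ_U` (`β ↦ β + ρ`,
`x_c ↦ x_c + ρβ`; constructed here with explicit inverse) by `Algebra.adjoin_induction`, and C2
`ToricExit.chartA_fixedPoints_eq` (p489078) applies to `σ_U`.
-/

-- single-problem summit: the doubled namespace component `ResolutionOfSingularities` is forced
set_option linter.dupNamespace false

noncomputable section

open MvPolynomial

namespace Summit.ResolutionOfSingularities.ResolutionOfSingularities.Theorems.WildQuotientResolution.ToricExit

/-- **The root-chart automorphism exists**: a `k`-algebra automorphism `σ_U` of `k[x]` with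
`σ_U x_b = x_b + x_a`, `σ_U x_c = x_c + x_a x_b`, `σ_U xᵢ = xᵢ` otherwise (`b ≠ c`, `a ≠ b`, `a ≠ c`;
inverse `x_b ↦ x_b − x_a`, `x_c ↦ x_c − x_a x_b + x_a²`). [folklore] -/
theorem exists_rootChartEquiv (k : Type) [Field k] (n : ℕ) (a b c : Fin n) (hab : a ≠ b)
    (hbc : b ≠ c) (hac : a ≠ c) :
    ∃ σU : MvPolynomial (Fin n) k ≃ₐ[k] MvPolynomial (Fin n) k,
      σU (X b) = X b + X a ∧ σU (X c) = X c + X a * X b ∧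
        ∀ i, i ≠ b → i ≠ c → σU (X i) = X i := by
  classical
  let φ : MvPolynomial (Fin n) k →ₐ[k] MvPolynomial (Fin n) k :=
    aeval fun i => if i = b then X b + X a else if i = c then X c + X a * X b else X i
  let φ' : MvPolynomial (Fin n) k →ₐ[k] MvPolynomial (Fin n) k :=
    aeval fun i => if i = b then X b - X a else if i = c then X c - X a * X b + X a ^ 2 else X i
  have hφb : φ (X b) = X b + X a := by
    change aeval _ (X b) = _
    rw [aeval_X, if_pos rfl]
  have hφc : φ (X c) = X c + X a * X b := by
    change aeval _ (X c) = _
    rw [aeval_X, if_neg (Ne.symm hbc), if_pos rfl]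
  have hφi : ∀ i, i ≠ b → i ≠ c → φ (X i) = X i := by
    intro i hib hic
    change aeval _ (X i) = _
    rw [aeval_X, if_neg hib, if_neg hic]
  have hφ'b : φ' (X b) = X b - X a := by
    change aeval _ (X b) = _
    rw [aeval_X, if_pos rfl]
  have hφ'c : φ' (X c) = X c - X a * X b + X a ^ 2 := by
    change aeval _ (X c) = _
    rw [aeval_X, if_neg (Ne.symm hbc), if_pos rfl]
  have hφ'i : ∀ i, i ≠ b → i ≠ c → φ' (X i) = X i := by
    intro i hib hic
    change aeval _ (X i) = _
    rw [aeval_X, if_neg hib, if_neg hic]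
  have hφa : φ (X a) = X a := hφi a hab hac
  have hφ'a : φ' (X a) = X a := hφ'i a hab hac
  have h1 : φ.comp φ' = AlgHom.id k _ := by
    refine MvPolynomial.algHom_ext fun i => ?_
    change φ (φ' (X i)) = X i
    by_cases hib : i = b
    · subst hib
      rw [hφ'b, map_sub, hφb, hφa]; ring
    · by_cases hic : i = c
      · subst hic
        rw [hφ'c, map_add, map_sub, map_mul, map_pow, hφc, hφa, hφb]; ring
      · rw [hφ'i i hib hic, hφi i hib hic]
  have h2 : φ'.comp φ = AlgHom.id k _ := by
    refine MvPolynomial.algHom_ext fun i => ?_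
    change φ' (φ (X i)) = X i
    by_cases hib : i = b
    · subst hib
      rw [hφb, map_add, hφ'b, hφ'a]; ring
    · by_cases hic : i = c
      · subst hic
        rw [hφc, map_add, map_mul, hφ'c, hφ'a, hφ'b]; ring
      · rw [hφi i hib hic, hφ'i i hib hic]
  exact ⟨AlgEquiv.ofAlgHom φ φ' h1 h2, hφb, hφc, hφi⟩

/-- **C2 for an abstract action given on generators** (res-L1-w45c-lead-1's I-7 input): see the
module docstring. [OURS · L1 W4.5c] -/
theorem chartA_fixedPoints_eq_of_generators (p : ℕ) (hp : p.Prime) (hp3 : 3 ≤ p) (k : Type)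
    [Field k] [CharP k p] (n : ℕ) (a b c : Fin n) (hab : a ≠ b) (hbc : b ≠ c) (hac : a ≠ c)
    (τ : ↥(Algebra.adjoin k (chartAGens k n a b)) →+* ↥(Algebra.adjoin k (chartAGens k n a b)))
    (hC : ∀ r : k, (τ (algebraMap k _ r) : MvPolynomial (Fin n) k) = C r)
    (h2a : (τ ⟨X a ^ 2, sq_a_mem_adjoin k n a b⟩ : MvPolynomial (Fin n) k) = X a ^ 2)
    (hab2 : (τ ⟨X a * X b, mul_ab_mem_adjoin k n a b⟩ : MvPolynomial (Fin n) k) =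
      X a * X b + X a ^ 2)
    (h2b : (τ ⟨X b ^ 2, sq_b_mem_adjoin k n a b⟩ : MvPolynomial (Fin n) k) =
      X b ^ 2 + 2 * (X a * X b) + X a ^ 2)
    (hc : (τ ⟨X c, X_mem_adjoin_of_ne k n a b c hac.symm hbc.symm⟩ : MvPolynomial (Fin n) k) =
      X c + X a * X b)
    (hσ : ∀ (i : Fin n) (hia : i ≠ a) (hib : i ≠ b), i ≠ c →
      (τ ⟨X i, X_mem_adjoin_of_ne k n a b i hia hib⟩ : MvPolynomial (Fin n) k) = X i) :
    {f : ↥(Algebra.adjoin k (chartAGens k n a b)) | τ f = f} =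
      {f : ↥(Algebra.adjoin k (chartAGens k n a b)) |
        (f : MvPolynomial (Fin n) k) ∈ Algebra.adjoin k (coneGens k p n a b c)} := by
  classical
  obtain ⟨σU, hb, hcU, hσU⟩ := exists_rootChartEquiv k n a b c hab hbc hac
  have ha : σU (X a) = X a := hσU a hab hac
  -- `τ` agrees with `σ_U` on the even subalgebra
  have hagree : ∀ (f : MvPolynomial (Fin n) k) (hf : f ∈ Algebra.adjoin k (chartAGens k n a b)),
      (τ ⟨f, hf⟩ : MvPolynomial (Fin n) k) = σU f := by
    intro f hf
    induction hf using Algebra.adjoin_induction with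
    | mem x hx =>
      rcases hx with hx | ⟨i, ⟨hia, hib⟩, rfl⟩
      · simp only [Set.mem_insert_iff, Set.mem_singleton_iff] at hx
        rcases hx with rfl | rfl | rfl
        · rw [map_pow, ha]
          exact h2a
        · rw [map_mul, ha, hb]
          rw [hab2]; ring
        · rw [map_pow, hb]
          rw [h2b]; ring
      · by_cases hic : i = c
        · subst hic
          rw [hcU]
          exact hc
        · rw [hσU i hib hic]
          exact hσ i hia hib hic
    | algebraMap r =>
      rw [AlgEquiv.commutes]
      exact hC r
    | add x y hx hy ihx ihy =>
      have e : (⟨x + y, Subalgebra.add_mem _ hx hy⟩ : ↥(Algebra.adjoin k (chartAGens k n a b))) =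
          ⟨x, hx⟩ + ⟨y, hy⟩ := rfl
      rw [e, map_add, Subalgebra.coe_add, ihx, ihy, map_add]
    | mul x y hx hy ihx ihy =>
      have e : (⟨x * y, Subalgebra.mul_mem _ hx hy⟩ : ↥(Algebra.adjoin k (chartAGens k n a b))) =
          ⟨x, hx⟩ * ⟨y, hy⟩ := rfl
      rw [e, map_mul, Subalgebra.coe_mul, ihx, ihy, map_mul]
  have hC2 := chartA_fixedPoints_eq p hp hp3 k n σU a b c hab hbc hac hb hcU hσU
  ext f
  constructor
  · intro hτ
    have hfix : σU (f : MvPolynomial (Fin n) k) = f := by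
      rw [← hagree f.1 f.2]
      exact congrArg Subtype.val hτ
    have hmem : (f : MvPolynomial (Fin n) k) ∈
        {g : MvPolynomial (Fin n) k | g ∈ Algebra.adjoin k (chartAGens k n a b) ∧ σU g = g} :=
      ⟨f.2, hfix⟩
    rw [hC2] at hmem
    exact hmem
  · intro hf
    have hmem : (f : MvPolynomial (Fin n) k) ∈
        (Algebra.adjoin k (coneGens k p n a b c) : Set (MvPolynomial (Fin n) k)) := hf
    rw [← hC2] at hmem
    obtain ⟨-, hfix⟩ := hmem
    apply Subtype.ext
    change (τ ⟨f.1, f.2⟩ : MvPolynomial (Fin n) k) = f.1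
    rw [hagree f.1 f.2]
    exact hfix

end Summit.ResolutionOfSingularities.ResolutionOfSingularities.Theorems.WildQuotientResolution.ToricExit

end
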